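import Summits.CriticalPhenomena.PercolationContinuityZ3.Theorems.PercNearOneGluingNoHeavyLowerTailMixCSHRminusCore
import Summits.CriticalPhenomena.PercolationContinuityZ3.Theorems.PercNearOneGluingNoHeavyLowerTailCSHUnfoldDecoy
import HarnessLib

/-!
# Mixed conditioned slack hierarchy — LEMMA R⁻ in the vocabulary of the unfolding (`CSH.resid`, worlds `η ∖ cut`)

Support file (`--supports stmt-CriticalPhenomena-4575`), prover `prim-ineq-gen-7` (gen 9).  No definitions, no named facts, no sorries.
Memo `prim-ineq-gen-7/PROOF-Q9-MIXED-CSH.md` §3.2–3.3; blueprint §10 brick B3 (this file CLOSES brick B3: the input `R_j ≤ 0` of the hub row of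
Lemma U, brick B2); write-up `Q9-WRITEUP.md` Lemma 5.5.

`CovTau.rminus_world` (…MixCSHRminusCore.lean) read through the dictionary `G[U] ↔ η ∩ edgesIn U ↔ η ∖ cut`:
* `MixCSH.resid_inter_edgesIn` — the telescoping residual `Θ = CSH.resid w x Y g` (prim-ineq-prove-1) of the configuration `η ∩ E(U)` is
  `1{x ↮ Y}·(g(C_x) − E_{G − C_Y} g(C_x))` of the world `G[U]`, the world mean being taken in the FULL graph minus the `G[U]`-cluster of `Y`;
* `MixCSH.rminus_edgesIn` — for every monotone `g` (no sign condition: `Θ` is shift invariant), `Y ⊆ Y' ⊆ U`, hub set `Σ`: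
  `Σ_η w(η) Θ(η∩E_U)·1{Σ ↮ Y'}(η∩E_U) ≤ (Σ_η w(η) Θ(η∩E_U))·(Σ_η w(η) 1{Σ ↮ Y'}(η∩E_U))`;
* `MixCSH.rminus_cut` — the same in the worlds `η ∖ cut_{d}(ζ)` of a decoy `d` with `d ↮ Y'` in `ζ` (the form produced by the Markov property at the
  cluster of the decoy, `HullPort.set_sum_cond_sdiff`, in the hub row of `CSH.decoy_world_term`): this is `R_j ≤ 0` of the memo, world by world.
[cite: VandenbergHaggstromKahn2005, Thm. 1.1 (pp. 3–5), §2.1 Lemma 2.4 (p. 10)] [cite: KozmaNitzan2024, Question 9 (§5.5 p. 36)]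
-/

noncomputable section

namespace Summit.CriticalPhenomena.PercolationContinuityZ3.Theorems

open Literature.Probability.Percolation
open Literature.Probability.Percolation.BHK2006
open Literature.Probability.Percolation.DecisionTree (ind ind_of_mem ind_of_not_mem ind_nonneg)
open scoped Classical

namespace MixCSH

open CovTau CSH HullPort

variable {V : Type*}

/-- Deleting the pairs meeting `W` is restricting to the pairs inside `V ∖ W`. [folklore] -/
theorem sdiff_edgesOf_eq_inter_edgesIn [Fintype V] (W : Set V) (β : Set (Sym2 V)) :
    β \ edgesOf W = β ∩ edgesIn (Finset.univ.filter fun u => u ∉ W) := by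
  ext e
  simp only [Set.mem_sdiff, edgesOf, Set.mem_setOf_eq, not_exists, not_and, Set.mem_inter_iff, edgesIn,
    Finset.mem_filter, Finset.mem_univ, true_and]

/-- The cut set of `Y` in the configuration `η ∩ E(U)` is the set of pairs meeting the `G[U]`-cluster of `Y`. [folklore] -/
theorem cut_inter_edgesIn_eq (U : Finset V) (Y : Set V) (η : Set (Sym2 V)) :
    cut Y (η ∩ edgesIn U) = edgesOf (sC U Y η) := rfl

/-- The worlds of a decoy: `η ∖ cut_{d}(ζ) = η ∩ E(V ∖ C_d(ζ))`. [folklore] -/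
theorem sdiff_cut_singleton_eq [Fintype V] (d : V) (ζ η : Set (Sym2 V)) :
    η \ cut {d} ζ = η ∩ edgesIn (Finset.univ.filter fun u => u ∉ openCluster ζ d) := by
  rw [cut_singleton_eq_edgesOf, sdiff_edgesOf_eq_inter_edgesIn]

/-- **The telescoping residual read in `G[U]`**: `Θ(η ∩ E(U)) = 1{x ↮ Y}·(g(C_x) − E_{G − C_Y} g(C_x))`, clusters computed in `G[U]`, the world
mean in the full graph minus the `G[U]`-cluster of `Y`. [cite: VandenbergHaggstromKahn2005, §2.1 Lemma 2.4 (p. 10)] -/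
theorem resid_inter_edgesIn [Fintype V] (w : Sym2 V → ℝ) (x : V) (Y : Set V) (g : Set (Sym2 V) → ℝ) (U : Finset V)
    (η : Set (Sym2 V)) :
    resid w x Y g (η ∩ edgesIn U) =
      ind (rD U x Y) η * (g (rC U x η) - tfE w (Finset.univ.filter fun u => u ∉ sC U Y η) x g) := by
  unfold resid wmeanOff tfE
  have h1 : ind (avoidEv x Y) (η ∩ edgesIn U) = ind (rD U x Y) η := rfl
  have h2 : ∀ β : Set (Sym2 V), β \ cut Y (η ∩ edgesIn U) = β ∩ edgesIn (Finset.univ.filter fun u => u ∉ sC U Y η) :=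
    fun β => by rw [cut_inter_edgesIn_eq, sdiff_edgesOf_eq_inter_edgesIn]
  simp only [h1, h2]
  rfl

/-- The residual is invariant under shifting `g` by a constant (normalised weights). [folklore] -/
theorem resid_sub_const [Fintype V] (w : Sym2 V → ℝ) (hm : ∑ ω, weight w ω = 1) (x : V) (Y : Set V)
    (g : Set (Sym2 V) → ℝ) (c : ℝ) (ζ : Set (Sym2 V)) :
    resid w x Y (fun C => g C - c) ζ = resid w x Y g ζ := by
  unfold resid wmeanOff
  have e : ∑ η, weight w η * (g (openEdgeCluster (η \ cut Y ζ) x) - c) =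
      ∑ η, weight w η * g (openEdgeCluster (η \ cut Y ζ) x) - c := by
    simp only [mul_sub, Finset.sum_sub_distrib, ← Finset.sum_mul, hm, one_mul]
  rw [e]; ring

/-- The hub avoidance test read in `G[U]`, with the hub set as a `Finset`. [folklore] -/
theorem ind_hubAvoid_inter_edgesIn [Fintype V] (Sig : Set V) (Y' : Set V) (U : Finset V) (η : Set (Sym2 V)) :
    ind {β : Set (Sym2 V) | ∀ σ ∈ Sig, ∀ a ∈ Y', ¬ (openGraph β).Reachable σ a} (η ∩ edgesIn U) =
      ind {ζ : Set (Sym2 V) | ∀ σ ∈ Sig.toFinset, ∀ a ∈ Y', ¬ (openGraph (ζ ∩ edgesIn U)).Reachable σ a} η := by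
  have hiff : η ∩ edgesIn U ∈ {β : Set (Sym2 V) | ∀ σ ∈ Sig, ∀ a ∈ Y', ¬ (openGraph β).Reachable σ a} ↔
      η ∈ {ζ : Set (Sym2 V) | ∀ σ ∈ Sig.toFinset, ∀ a ∈ Y', ¬ (openGraph (ζ ∩ edgesIn U)).Reachable σ a} := by
    simp only [Set.mem_setOf_eq, Set.mem_toFinset]
  by_cases h : η ∈ {ζ : Set (Sym2 V) | ∀ σ ∈ Sig.toFinset, ∀ a ∈ Y', ¬ (openGraph (ζ ∩ edgesIn U)).Reachable σ a}
  · rw [ind_of_mem h, ind_of_mem (hiff.2 h)]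
  · rw [ind_of_not_mem h, ind_of_not_mem (fun h' => h (hiff.1 h'))]

/-- **LEMMA R⁻, configurations read in `G[U]`** (memo §3.3): for a monotone `g`, `Y ⊆ Y' ⊆ U` and a hub set `Σ`,
`E_U[Θ·1{Σ ↮ Y'}] ≤ E_U[Θ]·E_U[1{Σ ↮ Y'}]` with `Θ = CSH.resid w x Y g` read on `η ∩ E(U)`.
[cite: VandenbergHaggstromKahn2005, Thm. 1.1 (pp. 3–5), §2.1 Lemma 2.4 (p. 10)] [cite: KozmaNitzan2024, Question 9 (§5.5 p. 36)] -/
theorem rminus_edgesIn [Fintype V] (w : Sym2 V → ℝ) (hw0 : ∀ e, 0 ≤ w e) (hw1 : ∀ e, w e ≤ 1) (hm : ∑ ω, weight w ω = 1)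
    (x : V) {Y Y' : Set V} (hYY' : Y ⊆ Y') {U : Finset V} (hY'U : Y' ⊆ ↑U) (Sig : Set V)
    {g : Set (Sym2 V) → ℝ} (hg : Monotone g) :
    ∑ η, weight w η * (resid w x Y g (η ∩ edgesIn U) *
        ind {β : Set (Sym2 V) | ∀ σ ∈ Sig, ∀ a ∈ Y', ¬ (openGraph β).Reachable σ a} (η ∩ edgesIn U)) ≤
      (∑ η, weight w η * resid w x Y g (η ∩ edgesIn U)) *
        ∑ η, weight w η * ind {β : Set (Sym2 V) | ∀ σ ∈ Sig, ∀ a ∈ Y', ¬ (openGraph β).Reachable σ a} (η ∩ edgesIn U) := by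
  -- shift `g` to be nonnegative
  set g₀ : Set (Sym2 V) → ℝ := fun C => g C - g ∅ with hg₀
  have hg₀m : Monotone g₀ := fun a b hab => sub_le_sub_right (hg hab) _
  have hg₀0 : ∀ C, 0 ≤ g₀ C := fun C => sub_nonneg.2 (hg (Set.empty_subset C))
  have hres : ∀ ζ : Set (Sym2 V), resid w x Y g ζ = resid w x Y g₀ ζ := fun ζ => (resid_sub_const w hm x Y g (g ∅) ζ).symm
  simp only [hres, resid_inter_edgesIn, ind_hubAvoid_inter_edgesIn]
  exact rminus_world w hw0 hw1 hm x hYY' hY'U Sig.toFinset hg₀m hg₀0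

/-- **LEMMA R⁻ in the worlds of a decoy** (memo §3.3, the input `R_j ≤ 0` of the hub row of Lemma U): for a configuration `ζ` with `d ↮ Y'`
(so the cluster `K = C_d(ζ)` misses `Y' ⊇ Y`), a monotone `g` and a hub set `Σ`, in the world `G − K` (configurations `η ∖ cut_{d}(ζ)`):
`Σ_η w(η) Θ(η∖cut)·1{Σ ↮ Y'}(η∖cut) ≤ (Σ_η w(η) Θ(η∖cut))·(Σ_η w(η) 1{Σ ↮ Y'}(η∖cut))`, `Θ = CSH.resid w x Y g` (GLOBAL world means).
[cite: VandenbergHaggstromKahn2005, Thm. 1.1 (pp. 3–5), §2.1 Lemma 2.4 (p. 10)] [cite: KozmaNitzan2024, Question 9 (§5.5 p. 36)] -/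
theorem rminus_cut [Fintype V] (w : Sym2 V → ℝ) (hw0 : ∀ e, 0 ≤ w e) (hw1 : ∀ e, w e ≤ 1) (hm : ∑ ω, weight w ω = 1)
    (x d : V) {Y Y' : Set V} (hYY' : Y ⊆ Y') (Sig : Set V) {g : Set (Sym2 V) → ℝ} (hg : Monotone g)
    {ζ : Set (Sym2 V)} (hd : ζ ∈ avoidEv d Y') :
    ∑ η, weight w η * (resid w x Y g (η \ cut {d} ζ) *
        ind {β : Set (Sym2 V) | ∀ σ ∈ Sig, ∀ a ∈ Y', ¬ (openGraph β).Reachable σ a} (η \ cut {d} ζ)) ≤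
      (∑ η, weight w η * resid w x Y g (η \ cut {d} ζ)) *
        ∑ η, weight w η * ind {β : Set (Sym2 V) | ∀ σ ∈ Sig, ∀ a ∈ Y', ¬ (openGraph β).Reachable σ a} (η \ cut {d} ζ) := by
  have hY'U : Y' ⊆ ↑(Finset.univ.filter fun u => u ∉ openCluster ζ d) := fun a ha => by
    simp only [Finset.coe_filter, Finset.mem_univ, true_and, Set.mem_setOf_eq]
    exact hd a ha
  simp only [sdiff_cut_singleton_eq]
  exact rminus_edgesIn w hw0 hw1 hm x hYY' hY'U Sig hg

end MixCSH

end Summit.CriticalPhenomena.PercolationContinuityZ3.Theorems
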